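/-
Copyright (c) 2026. All rights reserved.
Released under Apache 2.0 license as described in the file LICENSE.
-/
import Summits.HodgeConjecture.HodgeConjecture.Theorems.K2LiuLocalSiegelIwasawa   -- ★ the rational frame `Q`, `isSiegelDelta_frameConj`, `U(J_{2n}) = B·K`
import HarnessLib

/-!
# Crux `HLiu418`, #42S organ S1, ROAD W, file F3c-B5: `H_v = P_Δ · K₀` WITH `K₀` COMPACT AT EVERY FINITE PLACE (the `hIw` binder of ★ `spanning_criterion`)

Cell `hodgecm-mathlib`, crux item hLiu418 = `stmt-HodgeConjecture-24832`; squad K2 ∕ K2Liu; prover K2Liu-p06 (g4), the dedicated S1 hand.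
THEOREMS ONLY (no `def`, no instance, no notation, no named-fact hypothesis, no `sorry`); lane `--supports stmt-HodgeConjecture-24832 --as helper`.

★ F3b `spanning_criterion` only needs SOME compact `K₀ ⊆ H_v` with `H_v = P_Δ K₀` (not a hyperspecial one).  ★ `K2LiuLocalSiegelIwasawa.
exists_isSiegelDelta_mul_mem_localInt` gives `H_v = P_Δ · H(𝒪_v)` at the GOOD places (`|2|_w = 1`, `T₀^{±1}` integral); at an ARBITRARY finite place the
same transport of ★ `UnitaryGroup.exists_upper_mul_mem_localInt` (`U(J_{2n})(F_v) = B · U(J_{2n})(𝒪_v)`, every finite `v`) along the rational frame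
`Q = e₂ ∘ (1 D; 1 −D)`, `D = ½ T₀⁻¹ W`, gives `H_v = P_Δ · K₀` with `K₀ = Q U(J_{2n})(𝒪_v) Q⁻¹` — compact as the image of the compact ★ `UnitaryGroup.isCompact_localInt`
under the continuous ★ `FrameTransport.frameConj`, though no longer inside `H(𝒪_v)` when `Q` is not `v`-integral.
* **`exists_isCompact_isSiegelDelta_mul`**: `∃ K₀` compact, `∀ h, ∃ p ∈ P_Δ, ∃ k ∈ K₀, h = p k` — the `hIw` binder of ★ `spanning_criterion` BY VALUE, every finite `v`,
  in GR91 local currency (`P_Δ`-membership as ★ `IsSiegelDelta`; the K2Liu CM assembly converts with ★ `mem_siegelDeltaLoc_iff_local`).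
References: [BruhatTits1972] (4.4.3); [Tits1979] §3.3.2; [Casselman1980] §3; [HarrisKudlaSweet1996] §1 (1.11).
HONEST LABEL.  Count-neutral helper: `HC_CM` is proved only modulo the 7 printed citations (2 remaining named inputs: hLiu418 = `stmt-HodgeConjecture-24832`,
h413 = `stmt-HodgeConjecture-24833`) until rung 0 closes.
-/

set_option autoImplicit false
set_option linter.dupNamespace false -- the mandated namespace repeats `HodgeConjecture.HodgeConjecture`

noncomputable section

open NumberField IsDedekindDomain Matrix
open Literature.NumberTheory.Automorphic Literature.NumberTheory.Automorphic.UnitaryGroup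
open Literature.NumberTheory.GelbartRogawski1991.AdaptedBlocks
open Literature.NumberTheory.GelbartRogawski1991.UnitaryDualPair.LocalSplitting
open Summit.HodgeConjecture.HodgeConjecture.Cruxes.HLiu418.K2LiuLocalSiegelIwasawaFrame
open Summit.HodgeConjecture.HodgeConjecture.Cruxes.HLiu418.K2LiuLocalSiegelIwasawa

namespace Summit.HodgeConjecture.HodgeConjecture.Cruxes.HLiu418.K2LiuLocalSWIwasawaCompact

variable (F : Type) [Field F] [NumberField F] (E : Type) [Field E] [NumberField E] [Algebra F E]
  [Algebra.IsQuadraticExtension F E] (c : E ≃ₐ[F] E)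
  {δ : E} (hcδ : c δ = -δ) (hδ : δ ≠ 0) {d : F} (hd : δ * δ = algebraMap F E d)
  (v : HeightOneSpectrum (𝓞 F)) (n : ℕ) {T₀ : Matrix (Fin n) (Fin n) F} (hT₀ : T₀.IsSymm)
  {JD : Matrix (Fin (n + n)) (Fin (n + n)) E} (hJD : JD = (gramD F n T₀).map (algebraMap F E))

include hcδ hδ hd hT₀ hJD in
/-- **`H_v = P_Δ · K₀` WITH `K₀` COMPACT, AT EVERY FINITE PLACE.**  For every finite place `v` of `F` there is a compact `K₀ ⊆ H(F_v) = U(T₀ ⊕ −T₀)(F_v)` such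
that every `h ∈ H(F_v)` factors as `h = p · k` with `p ∈ P_Δ(F_v)` (★ `IsSiegelDelta`) and `k ∈ K₀`: `K₀ = Q · U(J_{2n})(𝒪_v) · Q⁻¹` for the rational frame `Q`
of ★ `K2LiuLocalSiegelIwasawa` (transport of ★ `UnitaryGroup.exists_upper_mul_mem_localInt`; compactness from ★ `UnitaryGroup.isCompact_localInt`).  The `hIw`
binder of ★ `spanning_criterion`.
[cite: BruhatTits1972, (4.4.3)] [cite: Tits1979, §3.3.2] [cite: Casselman1980, §3] [cite: HarrisKudlaSweet1996, §1 (1.11)] -/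
theorem exists_isCompact_isSiegelDelta_mul (hT₀d : IsUnit T₀.det) :
    ∃ K₀ : Set (UnitaryGroup.localPi E c (n + n) JD v), IsCompact K₀ ∧
      ∀ h : UnitaryGroup.localPi E c (n + n) JD v, ∃ p, IsSiegelDelta F E c hcδ hδ hd v n hT₀ hJD p ∧ ∃ k ∈ K₀, h = p * k := by
  classical
  -- the rational frame `Q` (as in ★ `exists_isSiegelDelta_mul_mem_localInt`)
  set D : Matrix (Fin n) (Fin n) F := (2 : F)⁻¹ • (T₀⁻¹ * (1 : Matrix (Fin n) (Fin n) F).submatrix id Fin.rev) with hD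
  set Qm : Matrix (Fin (n + n)) (Fin (n + n)) F := Matrix.reindex (e₂ n) (e₂ n) (Matrix.fromBlocks 1 D 1 (-D)) with hQm
  set Qi : Matrix (Fin (n + n)) (Fin (n + n)) F := Matrix.reindex (e₂ n) (e₂ n)
    (Matrix.fromBlocks ((2 : F)⁻¹ • (1 : Matrix (Fin n) (Fin n) F)) ((2 : F)⁻¹ • 1)
      ((1 : Matrix (Fin n) (Fin n) F).submatrix Fin.rev id * T₀) (-((1 : Matrix (Fin n) (Fin n) F).submatrix Fin.rev id * T₀))) with hQi
  have hmul : Qm * Qi = 1 := by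
    rw [hQm, hQi, reindex_mul_reindex, hD, frame_mul_frameInv hT₀d, Matrix.reindex_apply, Matrix.submatrix_one_equiv]
  have hmul' : Qi * Qm = 1 := by
    rw [hQm, hQi, reindex_mul_reindex, hD, frameInv_mul_frame hT₀d, Matrix.reindex_apply, Matrix.submatrix_one_equiv]
  let Q : GL (Fin (n + n)) F := ⟨Qm, Qi, hmul, hmul'⟩
  have hQval : (Q : Matrix (Fin (n + n)) (Fin (n + n)) F) = Matrix.reindex (e₂ n) (e₂ n) (Matrix.fromBlocks 1 D 1 (-D)) := rfl
  have hQ : (Q : Matrix (Fin (n + n)) (Fin (n + n)) F)ᵀ * gramD F n T₀ * (Q : Matrix (Fin (n + n)) (Fin (n + n)) F) =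
      (StdForm.antidiagonal (n + n)).over F := by
    rw [hQval, gramD, Matrix.transpose_reindex, reindex_mul_reindex, reindex_mul_reindex, hD, frame_transpose_mul_gram_mul_frame hT₀ hT₀d,
      reindex_antidiag_eq_antidiagonal_over]
  -- the frame conjugation `θ = Q · Q⁻¹ : U(J_{2n})(F_v) ≃ H(F_v)` and the compact `K₀ = θ(U(J_{2n})(𝒪_v))`
  set θ := FrameTransport.frameConj F E c v (n + n) hJD (antidiagonal_over_eq_map F E n) Q hQ with hθ
  refine ⟨θ '' (UnitaryGroup.localInt E c (n + n) ((StdForm.antidiagonal (n + n)).over E) v :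
      Set (UnitaryGroup.localPi E c (n + n) ((StdForm.antidiagonal (n + n)).over E) v)),
    (UnitaryGroup.isCompact_localInt E c (n + n) _ v).image θ.continuous, fun h => ?_⟩
  -- the Iwasawa decomposition of `θ⁻¹ h` in `U(J_{2n})(F_v)`
  obtain ⟨b', k', hb', hk', hbk⟩ :=
    UnitaryGroup.exists_upper_mul_mem_localInt c (galConj_ne_one_of_delta F E c hcδ hδ) (θ.symm h)
  refine ⟨θ b', isSiegelDelta_frameConj F E c hcδ hδ hd v n hT₀ hJD D Q hQval hQ b' hb', θ k', Set.mem_image_of_mem _ hk', ?_⟩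
  calc h = θ (θ.symm h) := (ContinuousMulEquiv.apply_symm_apply θ h).symm
    _ = θ b' * θ k' := by rw [hbk, map_mul]

end Summit.HodgeConjecture.HodgeConjecture.Cruxes.HLiu418.K2LiuLocalSWIwasawaCompact

end
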